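import Summits.QuantumFields.YangMills.Theorems.BalabanUVNodesSpineReadingOfRecord13CoPHKComponentSizeBlocksSkeletonNear
import Summits.QuantumFields.YangMills.Theorems.BalabanUVNodesSpineReadingOfRecord13CoPHKComponentSizeBlocksSkeletonReadings

/-!
# THE N20 LETTER ON THE SEQUENCE INDEX OF RECORD — the σ-packed key layer STRIPPED: at the identity dial the bad mass of ANY bad-key reading is, run by run, a plain sum of the
# (2.18) class weights `classWeightOfDatum₉` over the run's OWN admissible sequences of record whose key is bad; hence the one-block conditional INSIDE letter reads directly on
# `SeqOfRecord` («the sequences whose level-`j` small-field region `s.Λ j` misses the blocks …»), and the N20 face follows from letters stated in that index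

Cell `pub-ymgap`, YM-PLAN Track A (HUMAN RULING D-0062; width push D-0149); seat `pub-ymgap-dag-n20-d` (R134 (a) N20 NE7b s3 = the U5d ∕ `crOfRecord₁₃` lineage, its declarer)
gen 34; companion of `…CoPHKComponentSizeBlocksSkeletonNear` (gen 34: `relWeightBound_card_of_condInsideBlockLetters_id_supNear`), `…SpineReadingOfRecord13CoPH` (gen 28: `keyA₁₃`,
`keyB₁₃`, `classSet₁₃`, `weightA₁₃ ∕ weightB₁₃` = fibre sums of `Node00.classWeightOfDatum₉`), `…CoPHK` (gen 29: `classSetK₁₃_id`, `weightAK₁₃_id ∕ weightBK₁₃_id`) and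
`Node00/TwoRunSiteKey` (gen 27: `seqKey_snd`, `truncShift_Λ`).  `--kind proof --supports stmt-QuantumFields-27366 --as helper` (K3⁸); COUNT-NEUTRAL; THEOREMS ONLY (0 `def`).
[III] = [Balaban1988Convergent]; [LF-II] = [Balaban1989LargeFieldII].
WHY.  Every edition of the N20 letter so far is stated on the K-kit's carriers: σ-packed site-sequence keys `⟨K, y⟩`, coarse classes, `weightAK₁₃`.  A supplier working on NODE 00's
record (def-R's admissible sequences `SeqOfRecord F θ.ν θ.τ9.M g Kc k` and F3's class weights `classWeightOfDatum₉ … s = ∫ χ_k(s)·slot_k^{t,os}(s) dμ_k`, [III] (2.18) p. 257) should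
not have to unpack that layer.  This file does it once: §1 [folklore] a fibre-sum identity (`sum_filter_image_fiberSum_eq`); §2 ★★ `sum_badClassK_id_weightAK_eq_sum_seq` ∕ ★★
`…weightBK_eq_sum_seq` — at the identity dial and for ANY bad-key predicate `bd`, `Σ_{u ∈ bad} weightAK₁₃ u = Σ_{s : bd (keyA₁₃ s)} classWeightOfDatum₉ … (runA₁₃ …) … s` and likewise
for run B over its own sequences `s′` (cutoff `K₀ + K + 1`) with `keyB₁₃ s′`; the totals `sum_classSetK_id_weightAK_eq_sum_seq ∕ …BK…`; the dictionary `keyA₁₃_snd_snd`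
(`= s.Λ j`) and `twoRunKeyB_histB₁₃_snd_eq_blockDownSet` (`= blockDownSet (s′.Λ (j+1))` on the window, [III] (2.1) p. 254 — node U5d's flow-free truncation reads run B one level up);
§3 ★★★ `relWeightBound_card_of_condInsideSeqLetters_id_supNear` — the N20 face at the record's carriers from ONE-BLOCK CONDITIONAL INSIDE letters STATED ON THE SEQUENCE INDEX:
run A: «Σ over the sequences `s` whose `(s.Λ j)ᶜ` contains the blocks of `insert b S` ≤ η K j · Σ over those whose `(s.Λ j)ᶜ` contains the blocks of `S`» (`b` farther than
`ϱ K j` from `S`); run B: the same over its sequences `s′` with the region `(truncShift … s′).Λ j` of its key of record (`= blockDownSet (s′.Λ (j+1))` on the window).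
HONEST FRAMING.  [folklore] finite-sum bookkeeping BY NAME; the letters are HYPOTHESES (inhabited for no family today; NOT PRINTED as statements about the (2.18) class weights;
LCS-shaped; inhabitable only under a history-rewriting residual selector — (ρ1)∕(ρ2) of `…SpineReadingOfRecord13CoPH`); NO weight is bounded, NO estimate proved; nothing of
Bałaban's asserted; NE7 ∕ NE7b ∕ NE7c NOT PRINTED for `d = 4` ∕ NOT proved; no `Provisos₁₃CoPH` inhabitant claimed (K0⁷ OPEN); K3⁸ v7 untouched; N19 ∕ N20 ∕ N21 ∕ N27 NOT discharged;
counts UNMOVED (typed 28∕28 · discharged 8∕27); one finite four-torus programme at fixed `ε` — NOT ℝ⁴, NOT OS, NOT a mass gap, NOT the Clay problem.  No `def`, no `instance`, no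
`notation`, no `sorry`; no decl below carries a cite tag.
-/

noncomputable section

open scoped BigOperators
open Finset

namespace YMDAG.UVSplit

open Literature.MathematicalPhysics.QuantumFieldTheory.Balaban1983to89
open Literature.MathematicalPhysics.QuantumFieldTheory.Balaban1983to89.T4Continuum
open Literature.MathematicalPhysics.QuantumFieldTheory.Balaban1983to89.Node00
open Literature.MathematicalPhysics.QuantumFieldTheory.Balaban1983to89.B5Eq118OneStroke (iterBlockOf iterBlock)
open T4WeightBudget (RelWeightBound)

variable {F : T4Family} {N : ℕ} [NeZero N]

/-! ## §1 [folklore] A fibre-sum identity -/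

/-- [folklore] **SUMMING FIBRE SUMS OVER THE SELECTED PART OF THE IMAGE**: for a map `k` on a finite type, weights `f` and a predicate `P` on the target,
`Σ_{x ∈ (image k) with P x} Σ_{s : k s = x} f s = Σ_{s : P (k s)} f s`. [bookkeeping] -/
theorem sum_filter_image_fiberSum_eq {σ ι β : Type*} [Fintype σ] [DecidableEq ι] [AddCommMonoid β] (k : σ → ι) (f : σ → β) (P : ι → Prop) [DecidablePred P] :
    ∑ x ∈ (Finset.univ.image k).filter P, ∑ s ∈ Finset.univ.filter (fun s => k s = x), f s = ∑ s ∈ Finset.univ.filter (fun s => P (k s)), f s := by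
  rw [← Finset.sum_fiberwise_of_maps_to (s := Finset.univ.filter (fun s => P (k s))) (t := (Finset.univ.image k).filter P) (g := k)
    (fun s hs => Finset.mem_filter.2 ⟨Finset.mem_image_of_mem _ (Finset.mem_univ _), (Finset.mem_filter.1 hs).2⟩)]
  refine Finset.sum_congr rfl fun x hx => ?_
  have hPx : P x := (Finset.mem_filter.1 hx).2
  refine Finset.sum_congr ?_ fun _ _ => rfl
  ext s
  simp only [Finset.mem_filter, Finset.mem_univ, true_and]
  exact ⟨fun h => ⟨by rw [h]; exact hPx, h⟩, fun h => h.2⟩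

/-! ## §2 At the identity dial: bad masses and totals are sums over the runs' own sequences of record -/

section SeqIndex

variable (θ : Stage13HParams F N) (hP : θ.Provisos₁₃CoPH F N) (K₀ : ℕ) (g₀ : ℕ → ℝ) (os : List (ULoop F))
  (bd : ℕ → (Σ K, SiteSeqKey F (K₀ + K)) → Prop)

/-- **RUN A's KEY OF RECORD READS THE SEQUENCE's OWN SMALL-FIELD REGIONS**: `((keyA₁₃ s).2).2 j = s.Λ j` (`Node00.seqKey_snd`). [bookkeeping] -/
theorem keyA₁₃_snd_snd (K : ℕ) (s : SeqOfRecord F θ.ν θ.τ9.M (histA₁₃ θ K₀ g₀ K) (K₀ + K) (K₀ + K)) (j : ℕ) :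
    (keyA₁₃ θ K₀ g₀ K s).2.2 j = s.Λ j := rfl

/-- **RUN B's KEY OF RECORD READS RUN B ONE LEVEL UP, BLOCKED DOWN** (`0 < M`, window `1 ≤ j ≤ K₀ + K`): the level-`j` small-field region of node U5d's key
`twoRunKeyB … s′` is `blockDownSet F (K₀ + K) (s′.Λ (j + 1))` (`Node00.truncShift_Λ`; `keyB₁₃ s′ = ⟨K, twoRunKeyB … s′⟩` by `keyB₁₃_eq`). [bookkeeping] -/
theorem twoRunKeyB_histB₁₃_snd_eq_blockDownSet (hM : 0 < θ.τ9.M) (K : ℕ) (s' : SeqOfRecord F θ.ν θ.τ9.M (histB₁₃ θ K₀ g₀ K) (K₀ + K + 1) (K₀ + K + 1)) {j : ℕ}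
    (h1 : 1 ≤ j) (hj : j ≤ K₀ + K) :
    (twoRunKeyB F θ.ν hM (histB₁₃ θ K₀ g₀ K) (K₀ + K) (K₀ + K) s').2 j = blockDownSet F (K₀ + K) (s'.Λ (j + 1)) :=
  truncShift_Λ F θ.ν hM (histB₁₃ θ K₀ g₀ K) s' h1 hj

open scoped Classical in
/-- ★★ **RUN A: THE BAD MASS OF ANY BAD-KEY READING AT THE IDENTITY DIAL IS THE SUM OF THE (2.18) CLASS WEIGHTS OVER RUN A's SEQUENCES OF RECORD WHOSE KEY IS BAD** (the fibres
of `keyA₁₃` over the class set; the classes reached only by run B's key carry run-A weight `0`). [bookkeeping] -/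
theorem sum_badClassK_id_weightAK_eq_sum_seq (K : ℕ) (t : ℝ) :
    ∑ u ∈ badClassK₁₃ θ K₀ g₀ (fun _ x => x) bd K t, weightAK₁₃ θ hP K₀ g₀ os (fun _ x => x) K t u =
      ∑ s ∈ Finset.univ.filter (fun s => bd K (keyA₁₃ θ K₀ g₀ K s)),
        classWeightOfDatum₉ F N θ.toStage9Params (datumOfRecord₁₃CoPH F N θ hP) g₀ os (runA₁₃ F K₀ g₀ K) (histA₁₃ θ K₀ g₀ K) (K₀ + K) t s := by
  letI : ∀ Kc, DecidableEq (SiteSeqKey F Kc) := fun _ => Classical.decEq _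
  rw [weightAK₁₃_id]
  -- the bad class at the identity dial is the filtered class set of record
  have hbad : badClassK₁₃ θ K₀ g₀ (fun _ x => x) bd K t = (classSet₁₃ θ K₀ g₀ K).filter (bd K) := by
    ext u
    rw [mem_badClassK₁₃_iff, classSetK₁₃_id, Finset.mem_filter]
  rw [hbad]
  -- drop the classes outside run A's image: their run-A fibre is empty
  have hsub : (Finset.univ.image (keyA₁₃ θ K₀ g₀ K)).filter (bd K) ⊆ (classSet₁₃ θ K₀ g₀ K).filter (bd K) := by
    intro u hu
    rw [Finset.mem_filter] at hu ⊢
    exact ⟨Finset.mem_union_left _ hu.1, hu.2⟩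
  rw [← Finset.sum_subset hsub]
  · exact sum_filter_image_fiberSum_eq (keyA₁₃ θ K₀ g₀ K) _ (bd K)
  · intro u hu hnot
    refine Finset.sum_eq_zero fun s hs => ?_
    exfalso
    refine hnot (Finset.mem_filter.2 ⟨?_, (Finset.mem_filter.1 hu).2⟩)
    have hsu : keyA₁₃ θ K₀ g₀ K s = u := (Finset.mem_filter.1 hs).2
    exact hsu ▸ Finset.mem_image_of_mem _ (Finset.mem_univ s)

open scoped Classical in
/-- ★★ **RUN B: THE BAD MASS OF ANY BAD-KEY READING AT THE IDENTITY DIAL IS THE SUM OF THE (2.18) CLASS WEIGHTS OVER RUN B's SEQUENCES OF RECORD (cutoff `K₀ + K + 1`) WHOSE KEY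
IS BAD**. [bookkeeping] -/
theorem sum_badClassK_id_weightBK_eq_sum_seq (K : ℕ) (t : ℝ) :
    ∑ u ∈ badClassK₁₃ θ K₀ g₀ (fun _ x => x) bd K t, weightBK₁₃ θ hP K₀ g₀ os (fun _ x => x) K t u =
      ∑ s' ∈ Finset.univ.filter (fun s' => bd K (keyB₁₃ θ K₀ g₀ K s')),
        classWeightOfDatum₉ F N θ.toStage9Params (datumOfRecord₁₃CoPH F N θ hP) g₀ os (runB₁₃ F K₀ g₀ K) (histB₁₃ θ K₀ g₀ K) (K₀ + K + 1) t s' := by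
  letI : ∀ Kc, DecidableEq (SiteSeqKey F Kc) := fun _ => Classical.decEq _
  rw [weightBK₁₃_id]
  have hbad : badClassK₁₃ θ K₀ g₀ (fun _ x => x) bd K t = (classSet₁₃ θ K₀ g₀ K).filter (bd K) := by
    ext u
    rw [mem_badClassK₁₃_iff, classSetK₁₃_id, Finset.mem_filter]
  rw [hbad]
  have hsub : (Finset.univ.image (keyB₁₃ θ K₀ g₀ K)).filter (bd K) ⊆ (classSet₁₃ θ K₀ g₀ K).filter (bd K) := by
    intro u hu
    rw [Finset.mem_filter] at hu ⊢
    exact ⟨Finset.mem_union_right _ hu.1, hu.2⟩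
  rw [← Finset.sum_subset hsub]
  · exact sum_filter_image_fiberSum_eq (keyB₁₃ θ K₀ g₀ K) _ (bd K)
  · intro u hu hnot
    refine Finset.sum_eq_zero fun s hs => ?_
    exfalso
    refine hnot (Finset.mem_filter.2 ⟨?_, (Finset.mem_filter.1 hu).2⟩)
    have hsu : keyB₁₃ θ K₀ g₀ K s = u := (Finset.mem_filter.1 hs).2
    exact hsu ▸ Finset.mem_image_of_mem _ (Finset.mem_univ s)

/-- **RUN A's TOTAL AT THE IDENTITY DIAL IS THE SUM OF ALL ITS (2.18) CLASS WEIGHTS** (the bad-key reading `True`). [bookkeeping] -/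
theorem sum_classSetK_id_weightAK_eq_sum_seq (K : ℕ) (t : ℝ) :
    ∑ u ∈ classSetK₁₃ θ K₀ g₀ (fun _ x => x) K, weightAK₁₃ θ hP K₀ g₀ os (fun _ x => x) K t u =
      ∑ s : SeqOfRecord F θ.ν θ.τ9.M (histA₁₃ θ K₀ g₀ K) (K₀ + K) (K₀ + K),
        classWeightOfDatum₉ F N θ.toStage9Params (datumOfRecord₁₃CoPH F N θ hP) g₀ os (runA₁₃ F K₀ g₀ K) (histA₁₃ θ K₀ g₀ K) (K₀ + K) t s := by
  classical
  have h := sum_badClassK_id_weightAK_eq_sum_seq θ hP K₀ g₀ os (fun _ _ => True) K t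
  have hbad : badClassK₁₃ θ K₀ g₀ (fun _ x => x) (fun _ _ => True) K t = classSetK₁₃ θ K₀ g₀ (fun _ x => x) K := by
    ext u
    rw [mem_badClassK₁₃_iff]
    exact ⟨fun hu => hu.1, fun hu => ⟨hu, trivial⟩⟩
  rw [hbad] at h
  rw [h]
  exact Finset.sum_congr (by ext s; simp) fun _ _ => rfl

/-- **RUN B's TOTAL AT THE IDENTITY DIAL IS THE SUM OF ALL ITS (2.18) CLASS WEIGHTS**. [bookkeeping] -/
theorem sum_classSetK_id_weightBK_eq_sum_seq (K : ℕ) (t : ℝ) :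
    ∑ u ∈ classSetK₁₃ θ K₀ g₀ (fun _ x => x) K, weightBK₁₃ θ hP K₀ g₀ os (fun _ x => x) K t u =
      ∑ s' : SeqOfRecord F θ.ν θ.τ9.M (histB₁₃ θ K₀ g₀ K) (K₀ + K + 1) (K₀ + K + 1),
        classWeightOfDatum₉ F N θ.toStage9Params (datumOfRecord₁₃CoPH F N θ hP) g₀ os (runB₁₃ F K₀ g₀ K) (histB₁₃ θ K₀ g₀ K) (K₀ + K + 1) t s' := by
  classical
  have h := sum_badClassK_id_weightBK_eq_sum_seq θ hP K₀ g₀ os (fun _ _ => True) K t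
  have hbad : badClassK₁₃ θ K₀ g₀ (fun _ x => x) (fun _ _ => True) K t = classSetK₁₃ θ K₀ g₀ (fun _ x => x) K := by
    ext u
    rw [mem_badClassK₁₃_iff]
    exact ⟨fun hu => hu.1, fun hu => ⟨hu, trivial⟩⟩
  rw [hbad] at h
  rw [h]
  exact Finset.sum_congr (by ext s; simp) fun _ _ => rfl

open scoped Classical in
/-- ★★ **THE INSIDE EVENT ON RUN A's SEQUENCE INDEX**: at the identity dial, the run-A mass of the coarse classes whose level-`j` region contains the blocks of `A` is the sum of the
class weights over the sequences `s` with `↑(iterBlock lv b) ⊆ (s.Λ j)ᶜ` for all `b ∈ A`. [bookkeeping] -/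
theorem sum_badInside_id_weightAK_eq_sum_seq (K : ℕ) (t : ℝ) {lvl j : ℕ} (A : Finset (Site (F.P (K₀ + K)) lvl)) :
    ∑ u ∈ badClassK₁₃ θ K₀ g₀ (fun _ x => x) (fun _ u => ∀ y : SiteSeqKey F (K₀ + K), u = ⟨K, y⟩ →
        ∀ b ∈ A, (↑(iterBlock lvl b) : Set (Site (F.P (K₀ + K)) 0)) ⊆ (y.2 j)ᶜ) K t, weightAK₁₃ θ hP K₀ g₀ os (fun _ x => x) K t u =
      ∑ s ∈ Finset.univ.filter (fun s : SeqOfRecord F θ.ν θ.τ9.M (histA₁₃ θ K₀ g₀ K) (K₀ + K) (K₀ + K) =>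
          ∀ b ∈ A, (↑(iterBlock lvl b) : Set (Site (F.P (K₀ + K)) 0)) ⊆ (s.Λ j)ᶜ),
        classWeightOfDatum₉ F N θ.toStage9Params (datumOfRecord₁₃CoPH F N θ hP) g₀ os (runA₁₃ F K₀ g₀ K) (histA₁₃ θ K₀ g₀ K) (K₀ + K) t s := by
  rw [sum_badClassK_id_weightAK_eq_sum_seq]
  refine Finset.sum_congr ?_ fun _ _ => rfl
  ext s
  simp only [Finset.mem_filter, Finset.mem_univ, true_and]
  constructor
  · intro h
    exact h _ rfl
  · intro h y hy
    have hyy : y = (keyA₁₃ θ K₀ g₀ K s).2 := (eq_of_heq (Sigma.mk.inj hy).2).symm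
    rw [hyy]
    exact h

open scoped Classical in
/-- ★★ **THE INSIDE EVENT ON RUN B's SEQUENCE INDEX** (`0 < M`): likewise with run B's sequences `s′` and the level-`j` small-field region
`(truncShift … s′).Λ j` of node U5d's flow-free truncation (its key of record; on the window `= blockDownSet (s′.Λ (j+1))`, `twoRunKeyB_histB₁₃_snd_eq_blockDownSet`). [bookkeeping] -/
theorem sum_badInside_id_weightBK_eq_sum_seq (hM : 0 < θ.τ9.M) (K : ℕ) (t : ℝ) {lvl j : ℕ} (A : Finset (Site (F.P (K₀ + K)) lvl)) :
    ∑ u ∈ badClassK₁₃ θ K₀ g₀ (fun _ x => x) (fun _ u => ∀ y : SiteSeqKey F (K₀ + K), u = ⟨K, y⟩ →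
        ∀ b ∈ A, (↑(iterBlock lvl b) : Set (Site (F.P (K₀ + K)) 0)) ⊆ (y.2 j)ᶜ) K t, weightBK₁₃ θ hP K₀ g₀ os (fun _ x => x) K t u =
      ∑ s' ∈ Finset.univ.filter (fun s' : SeqOfRecord F θ.ν θ.τ9.M (histB₁₃ θ K₀ g₀ K) (K₀ + K + 1) (K₀ + K + 1) =>
          ∀ b ∈ A, (↑(iterBlock lvl b) : Set (Site (F.P (K₀ + K)) 0)) ⊆ ((truncShift F θ.ν hM (histB₁₃ θ K₀ g₀ K) s').Λ j)ᶜ),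
        classWeightOfDatum₉ F N θ.toStage9Params (datumOfRecord₁₃CoPH F N θ hP) g₀ os (runB₁₃ F K₀ g₀ K) (histB₁₃ θ K₀ g₀ K) (K₀ + K + 1) t s' := by
  rw [sum_badClassK_id_weightBK_eq_sum_seq]
  refine Finset.sum_congr ?_ fun _ _ => rfl
  ext s'
  simp only [Finset.mem_filter, Finset.mem_univ, true_and]
  rw [keyB₁₃_eq θ K₀ g₀ hM K s']
  constructor
  · intro h
    exact h _ rfl
  · intro h y hy
    have hyy : y = twoRunKeyB F θ.ν hM (histB₁₃ θ K₀ g₀ K) (K₀ + K) (K₀ + K) s' := (eq_of_heq (Sigma.mk.inj hy).2).symm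
    rw [hyy]
    exact h

end SeqIndex

/-! ## §3 The face from one-block conditional INSIDE letters STATED ON THE SEQUENCE INDEX -/

section Face

variable (θ : Stage13HParams F N) (hP : θ.Provisos₁₃CoPH F N) (K₀ : ℕ) (g₀ : ℕ → ℝ) (os : List (ULoop F)) (jcut : ℕ → ℕ) (ϱ k lv : ℕ → ℕ → ℕ)

open scoped Classical in
/-- ★★★ **THE N20 FACE AT THE RECORD's CARRIERS FROM ONE-BLOCK CONDITIONAL INSIDE LETTERS ON THE SEQUENCE INDEX OF RECORD** (`lv K j ≤ j`; metric separation
`SupNear (ϱ K j)`; schedule `k K j ≥ ⌈log₂ |Site_{lv K j}|⌉ + K + j + 3`; `0 ≤ η K j ≤ η₀ ≤ 1`, `2·((2ϱ+1)^4·81·(2ϱ+1)^4)²·η K j ≤ 1`).  Run A's letter: for every environment `S`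
of level-`lv K j` blocks and block `b ∉ S` farther than `ϱ K j` from `S`, the (2.18) class weights of run A's sequences of record whose level-`j` small-field region misses
the blocks of `insert b S` sum to at most `η K j` times those missing the blocks of `S`; run B's letter: the same over run B's sequences (cutoff `K₀ + K + 1`) with the
region `(truncShift … s′).Λ j` of its key of record (`0 < M`).  Conclusion: `RelWeightBound` at `crOfRecord₁₃K (keyReadingId₁₃ …) (badKeyReadingOfBigComponent₁₃ … (bigDialOfCard₁₃ K₀ ((2ϱ+1)^4·k·L^{4lv}))) …`'s
carriers with `W K := η₀ · 2^{−(K+1)}`. [bookkeeping] -/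
theorem relWeightBound_card_of_condInsideSeqLetters_id_supNear (hM : 0 < θ.τ9.M)
    {η : ℕ → ℕ → ℝ} {η₀ : ℝ} (hη0 : ∀ K j, 0 ≤ η K j) (hη1 : ∀ K j, η K j ≤ η₀) (hη₀ : η₀ ≤ 1)
    (hD : ∀ K j, 2 * ((((2 * ϱ K j + 1) ^ 4 : ℕ) : ℝ) * 3 ^ 4 * ((2 * ϱ K j + 1) ^ 4 : ℕ)) ^ 2 * η K j ≤ 1)
    (hks : ∀ K j, Nat.clog 2 (Fintype.card (Site (F.P (K₀ + K)) (lv K j))) + K + j + 3 ≤ k K j) (hlv : ∀ K j, lv K j ≤ F.m + (K₀ + K))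
    (hlvj : ∀ K, ∀ j ∈ Finset.Icc 1 (jcut K), lv K j ≤ j)
    (hCA : ∀ (K : ℕ) (t : ℝ), |t| ≤ 1 → ∀ j ∈ Finset.Icc 1 (jcut K), ∀ (S : Finset (Site (F.P (K₀ + K)) (lv K j))) (b : Site (F.P (K₀ + K)) (lv K j)),
      b ∉ S → (∀ s ∈ S, ¬ SupNear (ϱ K j) b s) →
      ∑ s ∈ Finset.univ.filter (fun s : SeqOfRecord F θ.ν θ.τ9.M (histA₁₃ θ K₀ g₀ K) (K₀ + K) (K₀ + K) =>
          ∀ b' ∈ insert b S, (↑(iterBlock (lv K j) b') : Set (Site (F.P (K₀ + K)) 0)) ⊆ (s.Λ j)ᶜ),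
        classWeightOfDatum₉ F N θ.toStage9Params (datumOfRecord₁₃CoPH F N θ hP) g₀ os (runA₁₃ F K₀ g₀ K) (histA₁₃ θ K₀ g₀ K) (K₀ + K) t s ≤
      η K j * ∑ s ∈ Finset.univ.filter (fun s : SeqOfRecord F θ.ν θ.τ9.M (histA₁₃ θ K₀ g₀ K) (K₀ + K) (K₀ + K) =>
          ∀ b' ∈ S, (↑(iterBlock (lv K j) b') : Set (Site (F.P (K₀ + K)) 0)) ⊆ (s.Λ j)ᶜ),
        classWeightOfDatum₉ F N θ.toStage9Params (datumOfRecord₁₃CoPH F N θ hP) g₀ os (runA₁₃ F K₀ g₀ K) (histA₁₃ θ K₀ g₀ K) (K₀ + K) t s)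
    (hCB : ∀ (K : ℕ) (t : ℝ), |t| ≤ 1 → ∀ j ∈ Finset.Icc 1 (jcut K), ∀ (S : Finset (Site (F.P (K₀ + K)) (lv K j))) (b : Site (F.P (K₀ + K)) (lv K j)),
      b ∉ S → (∀ s ∈ S, ¬ SupNear (ϱ K j) b s) →
      ∑ s' ∈ Finset.univ.filter (fun s' : SeqOfRecord F θ.ν θ.τ9.M (histB₁₃ θ K₀ g₀ K) (K₀ + K + 1) (K₀ + K + 1) =>
          ∀ b' ∈ insert b S, (↑(iterBlock (lv K j) b') : Set (Site (F.P (K₀ + K)) 0)) ⊆ ((truncShift F θ.ν hM (histB₁₃ θ K₀ g₀ K) s').Λ j)ᶜ),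
        classWeightOfDatum₉ F N θ.toStage9Params (datumOfRecord₁₃CoPH F N θ hP) g₀ os (runB₁₃ F K₀ g₀ K) (histB₁₃ θ K₀ g₀ K) (K₀ + K + 1) t s' ≤
      η K j * ∑ s' ∈ Finset.univ.filter (fun s' : SeqOfRecord F θ.ν θ.τ9.M (histB₁₃ θ K₀ g₀ K) (K₀ + K + 1) (K₀ + K + 1) =>
          ∀ b' ∈ S, (↑(iterBlock (lv K j) b') : Set (Site (F.P (K₀ + K)) 0)) ⊆ ((truncShift F θ.ν hM (histB₁₃ θ K₀ g₀ K) s').Λ j)ᶜ),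
        classWeightOfDatum₉ F N θ.toStage9Params (datumOfRecord₁₃CoPH F N θ hP) g₀ os (runB₁₃ F K₀ g₀ K) (histB₁₃ θ K₀ g₀ K) (K₀ + K + 1) t s') :
    RelWeightBound 1 (classSetK₁₃ θ K₀ g₀ (keyReadingId₁₃ N K₀ F θ hP g₀ os)) (weightAK₁₃ θ hP K₀ g₀ os (keyReadingId₁₃ N K₀ F θ hP g₀ os))
      (weightBK₁₃ θ hP K₀ g₀ os (keyReadingId₁₃ N K₀ F θ hP g₀ os))
      (badClassK₁₃ θ K₀ g₀ (keyReadingId₁₃ N K₀ F θ hP g₀ os)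
        (badKeyReadingOfBigComponent₁₃ N K₀ jcut (bigDialOfCard₁₃ K₀ (fun K j => (2 * ϱ K j + 1) ^ 4 * k K j * (F.L ^ 4) ^ lv K j)) F θ hP g₀ os))
      (fun K => η₀ * (1 / 2) ^ (K + 1)) := by
  refine relWeightBound_card_of_condInsideBlockLetters_id_supNear θ hP K₀ g₀ os jcut ϱ k lv hη0 hη1 hη₀ hD hks hlv hlvj ?_ ?_
  · intro K t ht j hj S b hbS hfar
    rw [sum_badInside_id_weightAK_eq_sum_seq, sum_badInside_id_weightAK_eq_sum_seq]
    exact hCA K t ht j hj S b hbS hfar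
  · intro K t ht j hj S b hbS hfar
    rw [sum_badInside_id_weightBK_eq_sum_seq θ hP K₀ g₀ os hM, sum_badInside_id_weightBK_eq_sum_seq θ hP K₀ g₀ os hM]
    exact hCB K t ht j hj S b hbS hfar

end Face

/-! ## §4 (v1.1, APPEND-ONLY; every declaration above byte-identical, one import added) The PRODUCT socket on the sequence index -/

section Product

variable (θ : Stage13HParams F N) (hP : θ.Provisos₁₃CoPH F N) (K₀ : ℕ) (g₀ : ℕ → ℝ) (os : List (ULoop F)) (jcut : ℕ → ℕ) (ϱ k lv : ℕ → ℕ → ℕ)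

open scoped Classical in
/-- ★★★ **THE N20 FACE AT THE RECORD's CARRIERS FROM PRODUCT INSIDE LETTERS ON ϱ-SEPARATED SKELETON FAMILIES, STATED ON THE SEQUENCE INDEX OF RECORD** (no conditioning — the
shape of a supplier that delivers «one factor `η K j` per `ϱ K j`-separated block», e.g. seat n20-c's one Peierls factor per skeleton cube; `lv K j ≤ j`; `0 < M`): for every member
`(y₀, A)` of `sepAnimalCoverFamily SiteTouch (SupNear (ϱ K j)) (k K j)`, the (2.18) class weights of run A's sequences of record whose level-`j` small-field region misses the blocks
of `A` sum to at most `η K j ^ (k K j)` times the sum of ALL of run A's class weights; run B likewise over its own sequences with the region `(truncShift … s′).Λ j`.  Numerics and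
schedule as in §3 (`…SkeletonReadings.relWeightBound_card_of_sepInsideBlockLetters_id_supNear` through §2's dictionary). [bookkeeping] -/
theorem relWeightBound_card_of_sepInsideSeqLetters_id_supNear (hM : 0 < θ.τ9.M)
    {η : ℕ → ℕ → ℝ} {η₀ : ℝ} (hη0 : ∀ K j, 0 ≤ η K j) (hη1 : ∀ K j, η K j ≤ η₀) (hη₀ : η₀ ≤ 1)
    (hD : ∀ K j, 2 * ((((2 * ϱ K j + 1) ^ 4 : ℕ) : ℝ) * 3 ^ 4 * ((2 * ϱ K j + 1) ^ 4 : ℕ)) ^ 2 * η K j ≤ 1)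
    (hks : ∀ K j, Nat.clog 2 (Fintype.card (Site (F.P (K₀ + K)) (lv K j))) + K + j + 3 ≤ k K j) (hlv : ∀ K j, lv K j ≤ F.m + (K₀ + K))
    (hlvj : ∀ K, ∀ j ∈ Finset.Icc 1 (jcut K), lv K j ≤ j)
    (hEA : ∀ (K : ℕ) (t : ℝ), |t| ≤ 1 → ∀ j ∈ Finset.Icc 1 (jcut K),
      ∀ p ∈ sepAnimalCoverFamily (SiteTouch (P := F.P (K₀ + K)) (j := lv K j)) (SupNear (P := F.P (K₀ + K)) (j := lv K j) (ϱ K j)) (k K j),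
      ∑ s ∈ Finset.univ.filter (fun s : SeqOfRecord F θ.ν θ.τ9.M (histA₁₃ θ K₀ g₀ K) (K₀ + K) (K₀ + K) =>
          ∀ b ∈ p.2, (↑(iterBlock (lv K j) b) : Set (Site (F.P (K₀ + K)) 0)) ⊆ (s.Λ j)ᶜ),
        classWeightOfDatum₉ F N θ.toStage9Params (datumOfRecord₁₃CoPH F N θ hP) g₀ os (runA₁₃ F K₀ g₀ K) (histA₁₃ θ K₀ g₀ K) (K₀ + K) t s ≤
      η K j ^ k K j * ∑ s : SeqOfRecord F θ.ν θ.τ9.M (histA₁₃ θ K₀ g₀ K) (K₀ + K) (K₀ + K),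
        classWeightOfDatum₉ F N θ.toStage9Params (datumOfRecord₁₃CoPH F N θ hP) g₀ os (runA₁₃ F K₀ g₀ K) (histA₁₃ θ K₀ g₀ K) (K₀ + K) t s)
    (hEB : ∀ (K : ℕ) (t : ℝ), |t| ≤ 1 → ∀ j ∈ Finset.Icc 1 (jcut K),
      ∀ p ∈ sepAnimalCoverFamily (SiteTouch (P := F.P (K₀ + K)) (j := lv K j)) (SupNear (P := F.P (K₀ + K)) (j := lv K j) (ϱ K j)) (k K j),
      ∑ s' ∈ Finset.univ.filter (fun s' : SeqOfRecord F θ.ν θ.τ9.M (histB₁₃ θ K₀ g₀ K) (K₀ + K + 1) (K₀ + K + 1) =>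
          ∀ b ∈ p.2, (↑(iterBlock (lv K j) b) : Set (Site (F.P (K₀ + K)) 0)) ⊆ ((truncShift F θ.ν hM (histB₁₃ θ K₀ g₀ K) s').Λ j)ᶜ),
        classWeightOfDatum₉ F N θ.toStage9Params (datumOfRecord₁₃CoPH F N θ hP) g₀ os (runB₁₃ F K₀ g₀ K) (histB₁₃ θ K₀ g₀ K) (K₀ + K + 1) t s' ≤
      η K j ^ k K j * ∑ s' : SeqOfRecord F θ.ν θ.τ9.M (histB₁₃ θ K₀ g₀ K) (K₀ + K + 1) (K₀ + K + 1),
        classWeightOfDatum₉ F N θ.toStage9Params (datumOfRecord₁₃CoPH F N θ hP) g₀ os (runB₁₃ F K₀ g₀ K) (histB₁₃ θ K₀ g₀ K) (K₀ + K + 1) t s') :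
    RelWeightBound 1 (classSetK₁₃ θ K₀ g₀ (keyReadingId₁₃ N K₀ F θ hP g₀ os)) (weightAK₁₃ θ hP K₀ g₀ os (keyReadingId₁₃ N K₀ F θ hP g₀ os))
      (weightBK₁₃ θ hP K₀ g₀ os (keyReadingId₁₃ N K₀ F θ hP g₀ os))
      (badClassK₁₃ θ K₀ g₀ (keyReadingId₁₃ N K₀ F θ hP g₀ os)
        (badKeyReadingOfBigComponent₁₃ N K₀ jcut (bigDialOfCard₁₃ K₀ (fun K j => (2 * ϱ K j + 1) ^ 4 * k K j * (F.L ^ 4) ^ lv K j)) F θ hP g₀ os))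
      (fun K => η₀ * (1 / 2) ^ (K + 1)) := by
  refine relWeightBound_card_of_sepInsideBlockLetters_id_supNear θ hP K₀ g₀ os jcut ϱ k lv hη0 hη1 hη₀ hD hks hlv hlvj ?_ ?_
  · intro K t ht j hj p hp
    rw [sum_badInside_id_weightAK_eq_sum_seq, sum_classSetK_id_weightAK_eq_sum_seq]
    exact hEA K t ht j hj p hp
  · intro K t ht j hj p hp
    rw [sum_badInside_id_weightBK_eq_sum_seq θ hP K₀ g₀ os hM, sum_classSetK_id_weightBK_eq_sum_seq]
    exact hEB K t ht j hj p hp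

end Product

end YMDAG.UVSplit

end
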